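import Summits.RiemannHypothesis.RiemannHypothesis.Theorems.SuzukiWindowsDoorArchLeadingSymbol
import Summits.RiemannHypothesis.RiemannHypothesis.Theorems.SuzukiWindowsDoorLaplacePower
import Summits.RiemannHypothesis.RiemannHypothesis.Theorems.SuzukiWindowsDoorWindowIdentity

/-!
# SuzukiWindowsDoorArchLeadingTerm — the small-`x` law `g_θ(x) = (2π)^θ x^{θ−1} e^{−x/2}/Γ(θ) · (1 + O(x))` with explicit constants (column DBR; RH-FREE)

RH-FREE throughout; nothing here bears on the truth of RH.  For INTEGER `θ = k + 1 ≥ 2` (the `θ ∈ ℕ` of the column's data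
ET1e/ET1f), Suzuki's archimedean kernel `g_θ = limArchKernel θ` ([Su20] = arXiv:1907.07302, (1.11)) satisfies

  `|g_θ(x) − (2π)^θ x^{k} e^{−x/2}/k!| ≤ 6θ · (2πe·x/θ)^θ · e^{−x/2}`   for `0 < x ≤ 1/6`,

i.e. `g_θ(x) = c_θ x^{θ−1} e^{−x/2} (1 + ρ)`, `c_θ = (2π)^θ/Γ(θ)` (DATA.md §ET1f-lite's certified constant), with
`|ρ| ≤ 6θ e^θ Γ(θ) θ^{−θ} · x` — and, by the first-window theorem (`SuzukiWindowsDoorWindowIdentity`), the same for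
`K_θ = limKernel θ` on `0 < x ≤ 1/6 (< log 2)`.  Method = the explicit-onset technique of `SuzukiWindowsDoorExplicitWindow`
applied to the REMAINDER: on the line `Re s = σ`, `‖Θ_θ^arch(s) − (2π)^θ s^{−θ}‖ ≤ 12θ(2π)^θ ‖s‖^{−θ−1}`
(`…ArchLeadingSymbol`), the exact transform of `(2π)^θ s^{−θ}` is `(2π)^θ x₊^k e^{−x/2}/k!` (`…LaplacePower`), so
`‖ĝ_θ(x) − (2π)^θ x₊^k e^{−x/2}/k!‖ ≤ (2π)⁻¹e^{bx}·12θ(2π)^θ σ^{−k}·π/σ = 6θ(2π)^θ σ^{−θ} e^{(σ−½)x}` for every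
`σ ≥ 6θ`; take `σ = θ/x`.

* §1 the power integrand `((½ − iz)^{k+1})⁻¹ e^{−izx}` on the line (`‖·‖ ≤ σ^{1−k}(σ²+u²)⁻¹e^{bx}`, integrable) and
  `∫ du/(σ²+u²) = π/σ`;
* §2 linearity of the line transform and **`norm_archTransform_sub_leading_le`** (every `σ ≥ 6θ`, every real `x`);
* §3 **`abs_limArchKernel_sub_leading_le`** and **`abs_limKernel_sub_leading_le`** (the small-`x` law, `0 < x ≤ 1/6`);
* §4 the leading constant as a limit: `g_θ(x)/(x^k e^{−x/2}) → (2π)^θ/k!` and `K_θ(x)/(x^k e^{−x/2}) → (2π)^θ/k!` as `x → 0⁺`.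

References: [Su20] M. Suzuki, ASPM 84 (2020), §3 (`g_θ` «by Stirling's formula»); DATA.md §ET1f-lite (c_θ‖A_θ‖, η₁ = −7/2).
-/

noncomputable section

-- D-0017: `Summit.<S>.<S>.…` is the designed namespace of a single-problem summit.
set_option linter.dupNamespace false

open MeasureTheory Set Filter Topology Complex

namespace Summit.RiemannHypothesis.RiemannHypothesis.Theorems.SuzukiWindowsDoorArchLeadingTerm

open Literature.NumberTheory.LFunctions
open SuzukiWindowsDoorArchKernel (re_half_sub_I_mul invFourierLine_limThetaArch_eq integrable_limThetaArch_lineIntegrand)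
open SuzukiWindowsDoorArchLeadingSymbol (norm_limThetaArch_sub_leading_le)
open SuzukiWindowsDoorLaplacePower (invFourierLine_inv_pow)
open SuzukiWindowsDoorExplicitSymbol (integral_inv_one_add_mul_sq integrable_inv_one_add_mul_sq)
open SuzukiWindowsDoorWindowIdentity (limKernel_eq_limArchKernel_of_lt_log_two)

/-! ## §1 The power integrand on the line `Im z = b` and `∫ du/(σ² + u²) = π/σ` -/

/-- `‖e^{−i(u+ib)x}‖ = e^{bx}` (private copy of the tree's `SuzukiDoor.norm_cexp_line`). -/
private theorem norm_cexp_neg_I_line (b x u : ℝ) :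
    ‖Complex.exp (-I * ((u : ℂ) + (b : ℂ) * I) * (x : ℂ))‖ = Real.exp (b * x) := by
  rw [Complex.norm_exp]
  congr 1
  simp only [Complex.mul_re, Complex.mul_im, Complex.neg_re, Complex.neg_im, Complex.add_re,
    Complex.add_im, Complex.I_re, Complex.I_im, Complex.ofReal_re, Complex.ofReal_im]
  ring

/-- `Re(½ − i(u + ib)) = ½ + b`. -/
theorem re_half_sub_line (u b : ℝ) : ((1 : ℂ) / 2 - I * ((u : ℂ) + (b : ℂ) * I)).re = 1 / 2 + b := by
  rw [re_half_sub_I_mul]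
  simp

/-- `‖½ − i(u + ib)‖² = (½ + b)² + u²`. -/
theorem normSq_half_sub_line (u b : ℝ) :
    ‖(1 : ℂ) / 2 - I * ((u : ℂ) + (b : ℂ) * I)‖ ^ 2 = (1 / 2 + b) ^ 2 + u ^ 2 := by
  rw [Complex.sq_norm, Complex.normSq_apply]
  simp [Complex.mul_re, Complex.mul_im]
  ring

/-- `‖½ − i(u+ib)‖^{k+j} ≥ σ^k (σ² + u²)^{…}`: precisely `σ^k · (σ² + u²) ≤ ‖½ − i(u+ib)‖^{k+2}`, `σ = ½ + b > 0`. -/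
theorem pow_mul_sq_le_norm_pow (k : ℕ) {b : ℝ} (hσ : 0 < 1 / 2 + b) (u : ℝ) :
    (1 / 2 + b) ^ k * ((1 / 2 + b) ^ 2 + u ^ 2) ≤ ‖(1 : ℂ) / 2 - I * ((u : ℂ) + (b : ℂ) * I)‖ ^ (k + 2) := by
  have hN : 1 / 2 + b ≤ ‖(1 : ℂ) / 2 - I * ((u : ℂ) + (b : ℂ) * I)‖ := by
    have h := Complex.re_le_norm ((1 : ℂ) / 2 - I * ((u : ℂ) + (b : ℂ) * I))
    rwa [re_half_sub_line] at h
  rw [pow_add, normSq_half_sub_line]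
  exact mul_le_mul_of_nonneg_right (pow_le_pow_left₀ hσ.le hN k) (by positivity)

/-- The power integrand is bounded on the line: `‖((½ − i(u+ib))^{k+1})⁻¹‖ ≤ σ^{−(k−1)} (σ² + u²)⁻¹` (`k ≥ 1`). -/
theorem norm_inv_pow_line_le {k : ℕ} (hk : 1 ≤ k) {b : ℝ} (hσ : 0 < 1 / 2 + b) (u : ℝ) :
    ‖(((1 : ℂ) / 2 - I * ((u : ℂ) + (b : ℂ) * I)) ^ (k + 1))⁻¹‖ ≤
      ((1 / 2 + b) ^ (k - 1))⁻¹ * ((1 / 2 + b) ^ 2 + u ^ 2)⁻¹ := by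
  have h := pow_mul_sq_le_norm_pow (k - 1) hσ u
  rw [show k - 1 + 2 = k + 1 by omega] at h
  rw [norm_inv, norm_pow, ← mul_inv]
  exact inv_anti₀ (by positivity) h

/-- The power integrand times `e^{−i(u+ib)x}` is integrable along the line (`k ≥ 1`, `σ = ½ + b > 0`). -/
theorem integrable_inv_pow_lineIntegrand {k : ℕ} (hk : 1 ≤ k) {b : ℝ} (hσ : 0 < 1 / 2 + b) (x : ℝ) :
    Integrable fun u : ℝ => (((1 : ℂ) / 2 - I * ((u : ℂ) + (b : ℂ) * I)) ^ (k + 1))⁻¹ *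
      Complex.exp (-I * ((u : ℂ) + (b : ℂ) * I) * (x : ℂ)) := by
  set σ : ℝ := 1 / 2 + b with hσdef
  have hc : 0 < (σ ^ 2)⁻¹ := by positivity
  have hne : ∀ u : ℝ, ((1 : ℂ) / 2 - I * ((u : ℂ) + (b : ℂ) * I)) ≠ 0 := fun u h => by
    have h' := congrArg Complex.re h
    rw [re_half_sub_line, Complex.zero_re] at h'
    linarith
  refine (((integrable_inv_one_add_mul_sq hc).const_mul ((σ ^ (k - 1))⁻¹ * Real.exp (b * x) * (σ ^ 2)⁻¹))).mono'
    ?_ (Eventually.of_forall fun u => ?_)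
  · exact ((Continuous.inv₀ (by fun_prop) fun u => pow_ne_zero _ (hne u)).mul (by fun_prop)).aestronglyMeasurable
  · rw [norm_mul, norm_cexp_neg_I_line]
    have h1 := norm_inv_pow_line_le hk hσ u
    have halg : (σ ^ 2 + u ^ 2)⁻¹ = (σ ^ 2)⁻¹ * (1 + (σ ^ 2)⁻¹ * u ^ 2)⁻¹ := by
      rw [← mul_inv]
      congr 1
      field_simp
    calc ‖(((1 : ℂ) / 2 - I * ((u : ℂ) + (b : ℂ) * I)) ^ (k + 1))⁻¹‖ * Real.exp (b * x)
        ≤ ((σ ^ (k - 1))⁻¹ * (σ ^ 2 + u ^ 2)⁻¹) * Real.exp (b * x) :=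
          mul_le_mul_of_nonneg_right h1 (Real.exp_pos _).le
      _ = (σ ^ (k - 1))⁻¹ * Real.exp (b * x) * (σ ^ 2)⁻¹ * (1 + (σ ^ 2)⁻¹ * u ^ 2)⁻¹ := by
          rw [halg]; ring

/-- `∫_ℝ du/(σ² + u²) = π/σ` (`σ > 0`). -/
theorem integral_inv_sq_add_sq {σ : ℝ} (hσ : 0 < σ) : ∫ u : ℝ, (σ ^ 2 + u ^ 2)⁻¹ = Real.pi / σ := by
  have hc : 0 < (σ ^ 2)⁻¹ := by positivity
  have hfun : (fun u : ℝ => (σ ^ 2 + u ^ 2)⁻¹) = fun u : ℝ => (σ ^ 2)⁻¹ * (1 + (σ ^ 2)⁻¹ * u ^ 2)⁻¹ := by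
    funext u
    rw [← mul_inv]
    congr 1
    field_simp
  rw [hfun, integral_const_mul, integral_inv_one_add_mul_sq hc, Real.sqrt_inv, Real.sqrt_sq hσ.le]
  field_simp

/-- Integrability of `u ↦ (σ² + u²)⁻¹` (`σ > 0`). -/
theorem integrable_inv_sq_add_sq {σ : ℝ} (hσ : 0 < σ) : Integrable fun u : ℝ => (σ ^ 2 + u ^ 2)⁻¹ := by
  have hc : 0 < (σ ^ 2)⁻¹ := by positivity
  have hfun : (fun u : ℝ => (σ ^ 2 + u ^ 2)⁻¹) = fun u : ℝ => (σ ^ 2)⁻¹ * (1 + (σ ^ 2)⁻¹ * u ^ 2)⁻¹ := by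
    funext u
    rw [← mul_inv]
    congr 1
    field_simp
  rw [hfun]
  exact (integrable_inv_one_add_mul_sq hc).const_mul _

/-! ## §2 The line transform of the remainder -/

/-- Linearity of the line transform: `invFourierLine (Θ − c·P) = invFourierLine Θ − c · invFourierLine P` when both
line integrands are integrable. -/
theorem invFourierLine_sub_const_mul {Φ Ψ : ℂ → ℂ} (c : ℂ) {b : ℝ} (x : ℝ)
    (hΦ : Integrable fun u : ℝ => Φ ((u : ℂ) + (b : ℂ) * I) * Complex.exp (-I * ((u : ℂ) + (b : ℂ) * I) * (x : ℂ)))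
    (hΨ : Integrable fun u : ℝ => Ψ ((u : ℂ) + (b : ℂ) * I) * Complex.exp (-I * ((u : ℂ) + (b : ℂ) * I) * (x : ℂ))) :
    invFourierLine (fun z => Φ z - c * Ψ z) b x = invFourierLine Φ b x - c * invFourierLine Ψ b x := by
  simp only [invFourierLine]
  have hint : ∫ u : ℝ, (Φ ((u : ℂ) + (b : ℂ) * I) - c * Ψ ((u : ℂ) + (b : ℂ) * I)) *
        Complex.exp (-I * ((u : ℂ) + (b : ℂ) * I) * (x : ℂ)) =
      (∫ u : ℝ, Φ ((u : ℂ) + (b : ℂ) * I) * Complex.exp (-I * ((u : ℂ) + (b : ℂ) * I) * (x : ℂ))) -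
        c * ∫ u : ℝ, Ψ ((u : ℂ) + (b : ℂ) * I) * Complex.exp (-I * ((u : ℂ) + (b : ℂ) * I) * (x : ℂ)) := by
    rw [← integral_const_mul, ← integral_sub hΦ (hΨ.const_mul c)]
    refine integral_congr_ae (Eventually.of_forall fun u => ?_)
    simp only
    ring
  rw [hint]
  ring

/-- RH-FREE.  **The archimedean transform minus its Stirling leading term, on any admissible line**: for integer
`θ = k+1 ≥ 2`, every `σ ≥ 6θ` and every real `x`,
`‖ĝ_θ(x) − (2π)^θ (max x 0)^k e^{−x/2}/k!‖ ≤ 6θ (2π)^θ σ^{−θ} e^{(σ−½)x}`,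
where `ĝ_θ(x) = invFourierLine Θ_θ^arch 1 x` (`g_θ = Re ĝ_θ`). -/
theorem norm_archTransform_sub_leading_le {k : ℕ} (hk : 1 ≤ k) {σ : ℝ} (hσ : 6 * ((k : ℝ) + 1) ≤ σ) (x : ℝ) :
    ‖invFourierLine (limThetaArch ((k : ℝ) + 1)) 1 x -
        (2 * Real.pi : ℂ) ^ (k + 1) * (((max x 0) ^ k * Real.exp (-(x / 2)) / (k.factorial : ℝ) : ℝ) : ℂ)‖ ≤
      6 * ((k : ℝ) + 1) * (2 * Real.pi) ^ (k + 1) / σ ^ (k + 1) * Real.exp ((σ - 1 / 2) * x) := by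
  have hk1 : (1 : ℝ) ≤ k := by exact_mod_cast hk
  have hθ : (1 : ℝ) < (k : ℝ) + 1 := by linarith
  have hσ12 : 12 ≤ σ := by linarith
  have hσpos : 0 < σ := by linarith
  set b : ℝ := σ - 1 / 2 with hbdef
  have hb : 1 / 2 < b := by rw [hbdef]; linarith
  have hb' : -1 / 2 < b := by linarith
  have hσb : 1 / 2 + b = σ := by rw [hbdef]; ring
  have hσb' : 0 < 1 / 2 + b := by rw [hσb]; exact hσpos
  -- the two known transforms on the line `Im z = b`
  have hA : invFourierLine (limThetaArch ((k : ℝ) + 1)) 1 x = invFourierLine (limThetaArch ((k : ℝ) + 1)) b x :=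
    invFourierLine_limThetaArch_eq hθ (by norm_num) hb x
  have hP : invFourierLine (fun z : ℂ => (((1 : ℂ) / 2 - I * z) ^ (k + 1))⁻¹) b x =
      (((max x 0) ^ k * Real.exp (-(x / 2)) / (k.factorial : ℝ) : ℝ) : ℂ) := invFourierLine_inv_pow hk hb' x
  have hIΘ := integrable_limThetaArch_lineIntegrand hθ hb x
  have hIP := integrable_inv_pow_lineIntegrand hk hσb' x
  rw [hA, ← hP, ← invFourierLine_sub_const_mul (Φ := limThetaArch ((k : ℝ) + 1))
    (Ψ := fun z : ℂ => (((1 : ℂ) / 2 - I * z) ^ (k + 1))⁻¹) ((2 * Real.pi : ℂ) ^ (k + 1)) x hIΘ hIP]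
  -- bound the line transform of the remainder
  refine (norm_invFourierLine_le _ b x).trans ?_
  have hC : 0 ≤ 12 * ((k : ℝ) + 1) * (2 * Real.pi) ^ (k + 1) * (σ ^ k)⁻¹ := by positivity
  have hpt : ∀ u : ℝ, ‖limThetaArch ((k : ℝ) + 1) ((u : ℂ) + (b : ℂ) * I) -
        (2 * Real.pi : ℂ) ^ (k + 1) * ((((1 : ℂ) / 2 - I * ((u : ℂ) + (b : ℂ) * I)) ^ (k + 1))⁻¹)‖ ≤
      12 * ((k : ℝ) + 1) * (2 * Real.pi) ^ (k + 1) * (σ ^ k)⁻¹ * (σ ^ 2 + u ^ 2)⁻¹ := by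
    intro u
    have hre : 6 * ((k : ℝ) + 1) ≤ ((1 : ℂ) / 2 - I * ((u : ℂ) + (b : ℂ) * I)).re := by
      rw [re_half_sub_line, hσb]; exact hσ
    refine (norm_limThetaArch_sub_leading_le k hre).trans ?_
    have hden : σ ^ k * (σ ^ 2 + u ^ 2) ≤ ‖(1 : ℂ) / 2 - I * ((u : ℂ) + (b : ℂ) * I)‖ ^ (k + 2) := by
      have h := pow_mul_sq_le_norm_pow k hσb' u
      rwa [hσb] at h
    have hden0 : 0 < σ ^ k * (σ ^ 2 + u ^ 2) := by positivity
    rw [div_eq_mul_inv, mul_assoc (12 * ((k : ℝ) + 1) * (2 * Real.pi) ^ (k + 1)), ← mul_inv]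
    exact mul_le_mul_of_nonneg_left (inv_anti₀ hden0 hden) (by positivity)
  have hint : ∫ u : ℝ, ‖limThetaArch ((k : ℝ) + 1) ((u : ℂ) + (b : ℂ) * I) -
        (2 * Real.pi : ℂ) ^ (k + 1) * ((((1 : ℂ) / 2 - I * ((u : ℂ) + (b : ℂ) * I)) ^ (k + 1))⁻¹)‖ ≤
      12 * ((k : ℝ) + 1) * (2 * Real.pi) ^ (k + 1) * (σ ^ k)⁻¹ * (Real.pi / σ) := by
    rw [← integral_inv_sq_add_sq hσpos, ← integral_const_mul]
    exact integral_mono_of_nonneg (Eventually.of_forall fun u => norm_nonneg _)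
      ((integrable_inv_sq_add_sq hσpos).const_mul _) (Eventually.of_forall hpt)
  calc 1 / (2 * Real.pi) * Real.exp (b * x) *
        ∫ u : ℝ, ‖limThetaArch ((k : ℝ) + 1) ((u : ℂ) + (b : ℂ) * I) -
          (2 * Real.pi : ℂ) ^ (k + 1) * ((((1 : ℂ) / 2 - I * ((u : ℂ) + (b : ℂ) * I)) ^ (k + 1))⁻¹)‖
      ≤ 1 / (2 * Real.pi) * Real.exp (b * x) *
          (12 * ((k : ℝ) + 1) * (2 * Real.pi) ^ (k + 1) * (σ ^ k)⁻¹ * (Real.pi / σ)) := by gcongr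
    _ = 6 * ((k : ℝ) + 1) * (2 * Real.pi) ^ (k + 1) / σ ^ (k + 1) * Real.exp ((σ - 1 / 2) * x) := by
        rw [hbdef, pow_succ]
        field_simp
        ring

/-! ## §3 The small-`x` law for `g_θ` and `K_θ` -/

/-- RH-FREE.  **SMALL-`x` LAW FOR `g_θ` (integer `θ = k+1 ≥ 2`)**: for `0 < x ≤ 1/6`,
`|g_θ(x) − (2π)^θ x^k e^{−x/2}/k!| ≤ 6θ · (2πe·x/θ)^θ · e^{−x/2}`
(the line `σ = θ/x` in `norm_archTransform_sub_leading_le`).  In relative form: `g_θ(x) = c_θ x^{θ−1}e^{−x/2}(1 + ρ(x))`,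
`c_θ = (2π)^θ/Γ(θ)`, `|ρ(x)| ≤ 6 θ e^θ Γ(θ) θ^{−θ} x`. -/
theorem abs_limArchKernel_sub_leading_le {k : ℕ} (hk : 1 ≤ k) {x : ℝ} (hx0 : 0 < x) (hx : x ≤ 1 / 6) :
    |limArchKernel ((k : ℝ) + 1) x - (2 * Real.pi) ^ (k + 1) * (x ^ k * Real.exp (-(x / 2)) / (k.factorial : ℝ))| ≤
      6 * ((k : ℝ) + 1) * (2 * Real.pi * Real.exp 1 * x / ((k : ℝ) + 1)) ^ (k + 1) * Real.exp (-(x / 2)) := by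
  have hk0 : (0 : ℝ) ≤ k := Nat.cast_nonneg k
  have hθpos : 0 < (k : ℝ) + 1 := by linarith
  set σ : ℝ := ((k : ℝ) + 1) / x with hσdef
  have hσ : 6 * ((k : ℝ) + 1) ≤ σ := by
    rw [hσdef, le_div_iff₀ hx0]
    nlinarith
  have h := norm_archTransform_sub_leading_le hk hσ x
  -- pass to the real part
  have hre : limArchKernel ((k : ℝ) + 1) x - (2 * Real.pi) ^ (k + 1) * (x ^ k * Real.exp (-(x / 2)) / (k.factorial : ℝ)) =
      (invFourierLine (limThetaArch ((k : ℝ) + 1)) 1 x -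
        (2 * Real.pi : ℂ) ^ (k + 1) * (((max x 0) ^ k * Real.exp (-(x / 2)) / (k.factorial : ℝ) : ℝ) : ℂ)).re := by
    rw [max_eq_left hx0.le, Complex.sub_re,
      show (2 * Real.pi : ℂ) ^ (k + 1) = (((2 * Real.pi) ^ (k + 1) : ℝ) : ℂ) by push_cast; ring,
      Complex.re_ofReal_mul]
    rfl
  rw [hre]
  refine (Complex.abs_re_le_norm _).trans (h.trans (le_of_eq ?_))
  -- `6θ(2π)^θ/σ^θ · e^{(σ−½)x} = 6θ (2πe x/θ)^θ e^{−x/2}` for `σ = θ/x`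
  have hexp : Real.exp ((σ - 1 / 2) * x) = Real.exp 1 ^ (k + 1) * Real.exp (-(x / 2)) := by
    rw [← Real.exp_nat_mul, ← Real.exp_add]
    congr 1
    rw [hσdef]
    field_simp
    push_cast
    ring
  rw [hexp, hσdef, div_pow, div_pow, mul_pow, mul_pow]
  field_simp
  ring

/-- RH-FREE.  **SMALL-`x` LAW FOR `K_θ`**: by the first-window theorem `K_θ = g_θ` on `(−∞, log 2)`, the same bound holds
for Suzuki's kernel `limKernel (k+1)` on `0 < x ≤ 1/6`. -/
theorem abs_limKernel_sub_leading_le {k : ℕ} (hk : 1 ≤ k) {x : ℝ} (hx0 : 0 < x) (hx : x ≤ 1 / 6) :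
    |limKernel ((k : ℝ) + 1) x - (2 * Real.pi) ^ (k + 1) * (x ^ k * Real.exp (-(x / 2)) / (k.factorial : ℝ))| ≤
      6 * ((k : ℝ) + 1) * (2 * Real.pi * Real.exp 1 * x / ((k : ℝ) + 1)) ^ (k + 1) * Real.exp (-(x / 2)) := by
  have hk0 : (0 : ℝ) ≤ k := Nat.cast_nonneg k
  have hθ : (1 : ℝ) < (k : ℝ) + 1 := by linarith [show (1 : ℝ) ≤ k from by exact_mod_cast hk]
  have hlog : x < Real.log 2 := by linarith [Real.log_two_gt_d9]
  rw [limKernel_eq_limArchKernel_of_lt_log_two hθ hlog]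
  exact abs_limArchKernel_sub_leading_le hk hx0 hx

/-! ## §4 The leading constant as a limit -/

/-- RH-FREE.  **`c_θ` as a limit**: for integer `θ = k+1 ≥ 2`,
`g_θ(x) / (x^k e^{−x/2}) → (2π)^θ/k! = (2π)^θ/Γ(θ)` as `x → 0⁺` (rate `≤ 6θ(2πe/θ)^θ · x` from the small-`x` law). -/
theorem tendsto_limArchKernel_div_leading {k : ℕ} (hk : 1 ≤ k) :
    Tendsto (fun x : ℝ => limArchKernel ((k : ℝ) + 1) x / (x ^ k * Real.exp (-(x / 2))))
      (𝓝[>] 0) (𝓝 ((2 * Real.pi) ^ (k + 1) / (k.factorial : ℝ))) := by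
  have hk0 : (0 : ℝ) ≤ k := Nat.cast_nonneg k
  have hθpos : 0 < (k : ℝ) + 1 := by linarith
  set C : ℝ := 6 * ((k : ℝ) + 1) * (2 * Real.pi * Real.exp 1 / ((k : ℝ) + 1)) ^ (k + 1) with hCdef
  have key : ∀ᶠ x in 𝓝[>] (0 : ℝ),
      ‖limArchKernel ((k : ℝ) + 1) x / (x ^ k * Real.exp (-(x / 2))) - (2 * Real.pi) ^ (k + 1) / (k.factorial : ℝ)‖ ≤
        C * x := by
    filter_upwards [Ioo_mem_nhdsGT (show (0 : ℝ) < 1 / 6 by norm_num)] with x hx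
    have hx0 : 0 < x := hx.1
    have hden : 0 < x ^ k * Real.exp (-(x / 2)) := by positivity
    have h := abs_limArchKernel_sub_leading_le hk hx0 hx.2.le
    rw [Real.norm_eq_abs,
      show limArchKernel ((k : ℝ) + 1) x / (x ^ k * Real.exp (-(x / 2))) - (2 * Real.pi) ^ (k + 1) / (k.factorial : ℝ) =
        (limArchKernel ((k : ℝ) + 1) x - (2 * Real.pi) ^ (k + 1) * (x ^ k * Real.exp (-(x / 2)) / (k.factorial : ℝ))) /
          (x ^ k * Real.exp (-(x / 2))) by field_simp,
      abs_div, abs_of_pos hden, div_le_iff₀ hden]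
    refine h.trans (le_of_eq ?_)
    rw [hCdef, div_pow, div_pow, mul_pow, mul_pow, mul_pow, pow_succ x k]
    ring
  have hlim : Tendsto (fun x : ℝ => C * x) (𝓝[>] 0) (𝓝 0) := by
    have h : Tendsto (fun x : ℝ => C * x) (𝓝 0) (𝓝 (C * 0)) :=
      (continuous_const.mul continuous_id).tendsto 0
    rw [mul_zero] at h
    exact h.mono_left nhdsWithin_le_nhds
  exact tendsto_sub_nhds_zero_iff.1 (squeeze_zero_norm' key hlim)

/-- RH-FREE.  The same limit for Suzuki's kernel `K_θ = limKernel θ` (first window). -/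
theorem tendsto_limKernel_div_leading {k : ℕ} (hk : 1 ≤ k) :
    Tendsto (fun x : ℝ => limKernel ((k : ℝ) + 1) x / (x ^ k * Real.exp (-(x / 2))))
      (𝓝[>] 0) (𝓝 ((2 * Real.pi) ^ (k + 1) / (k.factorial : ℝ))) := by
  have hk0 : (0 : ℝ) ≤ k := Nat.cast_nonneg k
  have hθ : (1 : ℝ) < (k : ℝ) + 1 := by linarith [show (1 : ℝ) ≤ k from by exact_mod_cast hk]
  refine (tendsto_limArchKernel_div_leading hk).congr' ?_
  filter_upwards [Ioo_mem_nhdsGT (show (0 : ℝ) < 1 / 6 by norm_num)] with x hx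
  have hlog : x < Real.log 2 := by linarith [Real.log_two_gt_d9, hx.2]
  rw [limKernel_eq_limArchKernel_of_lt_log_two hθ hlog]

end Summit.RiemannHypothesis.RiemannHypothesis.Theorems.SuzukiWindowsDoorArchLeadingTerm

end
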